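import Summits.ResolutionOfSingularities.ResolutionOfSingularities.Theorems.FrobeniusClosingPatchingRelPerfectThreeLetterStep
import Summits.ResolutionOfSingularities.ResolutionOfSingularities.Theorems.FrobeniusClosingPatchingRelPerfectChartQuotPackage
import HarnessLib

/-!
# Crux `PatchingRelPerfect` (stmt-ResolutionOfSingularities-16161), chain w52 — rung toolkit:
# the three-letter step under PAIR hypotheses (no integrality of `V(c)` or `V(o)`)

[OURS · L1 W5.2 · rung tool] `…ThreeLetterStep` reproduces, on the `ℓ`-chart `D` of `Bl_{(c,ℓ)}`, the
hypotheses `H(R; c, ℓ, o)` of the three-letter tower; two of them — `R/(c)` and `R/(o)` DOMAINS — are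
not available for the contact-migration member `(x₀x₁ + x₂² + x₃³) + 𝔪⁴` over an arbitrary regular
local base (this seat's PLAN-A2-certificate.md, obligations O0/O1).  They are replaced here by the
weaker PAIR hypotheses `ℓ`, `o` regular modulo `c` (i.e. `[c, ℓ]`, `[c, o]` weakly regular), which the
step reproduces as well (brick 6, `…ChartQuotPackage`).  PROVED, for `(c, ℓ)` quasi-regular with
`R/(c, ℓ)` a domain:

* `stepP_isRegularRing_quot_c'` — `D/(c')` regular from `R/(c)` regular and `ℓ` regular mod `c`;
* `stepP_isRegularRing_quot_c'o'`, `stepP_isDomain_quot_c'o'` — `D/(c', o') ≅ R/(c, o)`;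
* `stepP_chartBase_notMem_pair`, `stepP_ℓ'_notMem` — `r ∉ (c) + (o) ⇒ ψ r ∉ (c') + (o')`;
* `stepP_isSMulRegular_ℓ'`, `stepP_isSMulRegular_o'` — `ℓ'`, `o'` regular modulo `c'` (the pair
  hypotheses one level up); `stepP_isQuasiRegular_c'ℓ'`, `stepP_isQuasiRegular_c'o'` — the two
  possible next centres are quasi-regular (input format of the regular-centre blow-up).

The unchanged outputs (`D` regular / a domain, `D/(c',ℓ')`, the triple `D/(c',ℓ',o')`, `o' ∉ (c',ℓ')`)
are `step_*` of `…ThreeLetterStep`.  Arbitrary commutative rings; nothing here is a statement of the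
manuscript under review.

## References

* U. Görtz, T. Wedhorn, *Algebraic Geometry I*, 2nd ed. 2020, Prop. 13.96 (2), (13.19). [GortzWedhorn2020]
* H. Matsumura, *Commutative Ring Theory*, CUP 1986, Thm. 16.2 (i). [Matsumura1987]
* The Stacks Project, Tag 0804. [StacksProject]
-/

-- `Summit.<Summit>.<Sub>.Theorems` with `Sub = Summit` (single-conjunct summit, D-0017)
set_option linter.dupNamespace false

noncomputable section

open CategoryTheory CategoryTheory.Limits AlgebraicGeometry Literature.AlgebraicGeometry.Resolution
open IsLocalRing

namespace Summit.ResolutionOfSingularities.ResolutionOfSingularities.Theorems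

namespace ConeRung

universe u

/-- `b` regular on `A/(a)` ⇒ `b̄` is a non-zero-divisor of `A/(a)`. [folklore] -/
theorem mk_mem_nonZeroDivisors_of_isSMulRegular {A : Type u} [CommRing A] (a b : A)
    (h : IsSMulRegular (A ⧸ Ideal.span {a}) b) :
    Ideal.Quotient.mk (Ideal.span {a}) b ∈ nonZeroDivisors (A ⧸ Ideal.span {a}) := by
  refine mem_nonZeroDivisors_iff_right.mpr fun x hx => ?_
  obtain ⟨y, rfl⟩ := Ideal.Quotient.mk_surjective x
  rw [← map_mul, Ideal.Quotient.eq_zero_iff_mem, mul_comm] at hx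
  exact Ideal.Quotient.eq_zero_iff_mem.mpr ((isSMulRegular_quot_span_iff a b).mp h y hx)

section StepPairs

variable {R : Type u} [CommRing R] (c ℓ o : R)
  (hcl : IsQuasiRegular (Fin.cons c (fun _ : Fin 1 => ℓ) : Fin 2 → R))

local notation3 "cc" => (Fin.cons c (fun _ : Fin 1 => ℓ) : Fin 2 → R)
local notation3 "II" => Ideal.span (Set.range (Fin.cons c (fun _ : Fin 1 => ℓ) : Fin 2 → R))
local notation3 "D" => chartRing cc (Fin.succ 0)
local notation3 "ψ" => chartBase cc (Fin.succ 0)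
local notation3 "ℓ'" => chartBase cc (Fin.succ 0) (cc (Fin.succ 0))
local notation3 "c'" => chartGen cc (Fin.succ 0) 0
local notation3 "o'" => chartBase cc (Fin.succ 0) o

include hcl in
/-- `D ⧸ (c')` is a regular ring (`≅ R/(c)`), `ℓ` regular modulo `c`.
[cite: GortzWedhorn2020, Prop. 13.96 (2), (13.19)] -/
theorem stepP_isRegularRing_quot_c' [IsDomain (R ⧸ Ideal.span {c, ℓ})]
    [IsRegularRing (R ⧸ Ideal.span {c})] (hℓc : IsSMulRegular (R ⧸ Ideal.span {c}) ℓ) :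
    IsRegularRing (D ⧸ Ideal.span {c'}) := by
  haveI : IsDomain (R ⧸ II) := by rw [← step_span_pair_eq]; infer_instance
  obtain ⟨E₁, -, -⟩ := pairs_quot_package c ℓ c hcl (mk_mem_nonZeroDivisors_of_isSMulRegular c ℓ hℓc)
  exact IsRegularRing.of_ringEquiv E₁.symm

include hcl in
/-- `D ⧸ (c', o')` is a regular ring (`≅ R/(c, o)`), `ℓ` regular modulo `c`.
[cite: GortzWedhorn2020, Prop. 13.96 (2)] -/
theorem stepP_isRegularRing_quot_c'o' [IsDomain (R ⧸ Ideal.span {c, ℓ})]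
    [IsRegularRing (R ⧸ Ideal.span {c, o})] (hℓc : IsSMulRegular (R ⧸ Ideal.span {c}) ℓ) :
    IsRegularRing (D ⧸ Ideal.span {c', o'}) := by
  haveI : IsDomain (R ⧸ II) := by rw [← step_span_pair_eq]; infer_instance
  obtain ⟨-, E₂, -⟩ := pairs_quot_package c ℓ o hcl (mk_mem_nonZeroDivisors_of_isSMulRegular c ℓ hℓc)
  have h1 : Ideal.span {c', o'} = Ideal.span {c'} ⊔ Ideal.span {o'} := Ideal.span_insert _ _
  have h2 : Ideal.span {c, o} = Ideal.span {c} ⊔ Ideal.span {o} := Ideal.span_insert _ _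
  haveI : IsRegularRing (R ⧸ (Ideal.span {c} ⊔ Ideal.span {o})) :=
    IsRegularRing.of_ringEquiv (Ideal.quotEquivOfEq h2)
  exact IsRegularRing.of_ringEquiv ((Ideal.quotEquivOfEq h1).trans E₂).symm

include hcl in
/-- `D ⧸ (c', o')` is a domain (`≅ R/(c, o)`), `ℓ` regular modulo `c`.
[cite: GortzWedhorn2020, Prop. 13.96 (2)] -/
theorem stepP_isDomain_quot_c'o' [IsDomain (R ⧸ Ideal.span {c, ℓ})]
    [IsDomain (R ⧸ Ideal.span {c, o})] (hℓc : IsSMulRegular (R ⧸ Ideal.span {c}) ℓ) :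
    IsDomain (D ⧸ Ideal.span {c', o'}) := by
  haveI : IsDomain (R ⧸ II) := by rw [← step_span_pair_eq]; infer_instance
  obtain ⟨-, E₂, -⟩ := pairs_quot_package c ℓ o hcl (mk_mem_nonZeroDivisors_of_isSMulRegular c ℓ hℓc)
  have h1 : Ideal.span {c', o'} = Ideal.span {c'} ⊔ Ideal.span {o'} := Ideal.span_insert _ _
  have h2 : Ideal.span {c, o} = Ideal.span {c} ⊔ Ideal.span {o} := Ideal.span_insert _ _
  haveI : IsDomain (R ⧸ (Ideal.span {c} ⊔ Ideal.span {o})) :=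
    MulEquiv.isDomain _ (Ideal.quotEquivOfEq h2).symm.toMulEquiv
  exact MulEquiv.isDomain _ ((Ideal.quotEquivOfEq h1).trans E₂).toMulEquiv

include hcl in
/-- **Values**: `r ∉ (c) + (o) ⇒ ψ r ∉ (c') + (o')` (through `E₁ : D/(c') ≅ R/(c)`, `[ψ r] ↦ [r]`).
[cite: GortzWedhorn2020, (13.19)] -/
theorem stepP_chartBase_notMem_pair [IsDomain (R ⧸ Ideal.span {c, ℓ})]
    (hℓc : IsSMulRegular (R ⧸ Ideal.span {c}) ℓ) {r : R}
    (hr : r ∉ Ideal.span {c} ⊔ Ideal.span {o}) : ψ r ∉ Ideal.span {c'} ⊔ Ideal.span {o'} := by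
  haveI : IsDomain (R ⧸ II) := by rw [← step_span_pair_eq]; infer_instance
  obtain ⟨E₁, -, hE₁⟩ :=
    pairs_quot_package c ℓ o hcl (mk_mem_nonZeroDivisors_of_isSMulRegular c ℓ hℓc)
  intro h
  apply hr
  have h1 : Ideal.Quotient.mk (Ideal.span {c'}) (ψ r) ∈
      (Ideal.span {o'}).map (Ideal.Quotient.mk (Ideal.span {c'})) := by
    rw [← Ideal.mem_comap, Ideal.comap_map_of_surjective' _ Ideal.Quotient.mk_surjective,
      Ideal.mk_ker, sup_comm]
    exact h
  rw [Ideal.map_span _ ({o'} : Set D), Set.image_singleton, Ideal.mem_span_singleton'] at h1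
  obtain ⟨a, ha⟩ := h1
  obtain ⟨b, hb⟩ := Ideal.Quotient.mk_surjective a
  have h2 := congrArg E₁ ha
  rw [map_mul, ← hb, hE₁ o, hE₁ r] at h2
  obtain ⟨s, hs⟩ := Ideal.Quotient.mk_surjective (E₁ (Ideal.Quotient.mk _ b))
  rw [← hs, ← map_mul, Ideal.Quotient.eq, Ideal.mem_span_singleton'] at h2
  obtain ⟨d, hd⟩ := h2
  have e : r = s * o - d * c := by rw [hd]; ring
  rw [e]
  exact Ideal.sub_mem _ (Ideal.mem_sup_right (Ideal.mem_span_singleton'.mpr ⟨s, rfl⟩))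
    (Ideal.mem_sup_left (Ideal.mem_span_singleton'.mpr ⟨d, rfl⟩))

include hcl in
/-- `ℓ' ∉ (c', o')` when `ℓ ∉ (c, o)`, `ℓ` regular modulo `c`. [folklore] -/
theorem stepP_ℓ'_notMem [IsDomain (R ⧸ Ideal.span {c, ℓ})]
    (hℓc : IsSMulRegular (R ⧸ Ideal.span {c}) ℓ) (hℓ : ℓ ∉ Ideal.span {c, o}) :
    ℓ' ∉ Ideal.span {c', o'} := by
  have h := stepP_chartBase_notMem_pair c ℓ o hcl hℓc (r := ℓ) (by rwa [← Ideal.span_insert])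
  rwa [← Ideal.span_insert] at h

include hcl in
/-- **`ℓ'` is regular modulo `c'`** (`[c', ℓ']` weakly regular: swap of the chart family), `R` a
domain, `ℓ ≠ 0`. [cite: Matsumura1987, Thm. 16.2 (i)] -/
theorem stepP_isSMulRegular_ℓ' [IsDomain R] [Nontrivial (R ⧸ Ideal.span {c, ℓ})] (hℓ0 : ℓ ≠ 0) :
    IsSMulRegular (D ⧸ Ideal.span {c'}) ℓ' := by
  haveI : Nontrivial (R ⧸ II) := by rw [← step_span_pair_eq]; infer_instance
  exact ((isWeaklyRegular_pair_iff c' ℓ').mp (pairs_isWeaklyRegular_c'ℓ' c ℓ hcl hℓ0)).2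

include hcl in
/-- **`o'` is regular modulo `c'`** when `o` and `ℓ` are regular modulo `c`.
[cite: Matsumura1987, Thm. 16.2 (i)] -/
theorem stepP_isSMulRegular_o' [IsDomain (R ⧸ Ideal.span {c, ℓ})]
    (hℓc : IsSMulRegular (R ⧸ Ideal.span {c}) ℓ) (hoc : IsSMulRegular (R ⧸ Ideal.span {c}) o) :
    IsSMulRegular (D ⧸ Ideal.span {c'}) o' := by
  haveI : IsDomain (R ⧸ II) := by rw [← step_span_pair_eq]; infer_instance
  exact pairs_isSMulRegular_transport c ℓ o hcl (mk_mem_nonZeroDivisors_of_isSMulRegular c ℓ hℓc)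
    hoc

include hcl in
/-- **`(c', ℓ')` is quasi-regular** under the pair hypotheses. [cite: Matsumura1987, Thm. 16.2 (i)] -/
theorem stepP_isQuasiRegular_c'ℓ' [IsDomain R] [Nontrivial (R ⧸ Ideal.span {c, ℓ})] (hℓ0 : ℓ ≠ 0) :
    IsQuasiRegular (Fin.cons c' (fun _ : Fin 1 => ℓ') : Fin 2 → D) := by
  haveI : Nontrivial (R ⧸ II) := by rw [← step_span_pair_eq]; infer_instance
  exact isQuasiRegular_of_isWeaklyRegular _ (pairs_isWeaklyRegular_c'ℓ' c ℓ hcl hℓ0)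

include hcl in
/-- **`(c', o')` is quasi-regular** under the pair hypotheses. [cite: Matsumura1987, Thm. 16.2 (i)] -/
theorem stepP_isQuasiRegular_c'o' [IsDomain R] [IsDomain (R ⧸ Ideal.span {c, ℓ})] (hℓ0 : ℓ ≠ 0)
    (hℓc : IsSMulRegular (R ⧸ Ideal.span {c}) ℓ) (hoc : IsSMulRegular (R ⧸ Ideal.span {c}) o) :
    IsQuasiRegular (Fin.cons c' (fun _ : Fin 1 => o') : Fin 2 → D) := by
  haveI : IsDomain (R ⧸ II) := by rw [← step_span_pair_eq]; infer_instance
  exact isQuasiRegular_of_isWeaklyRegular _ (pairs_isWeaklyRegular_c'o' c ℓ o hcl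
    (mk_mem_nonZeroDivisors_of_isSMulRegular c ℓ hℓc) hoc hℓ0)

end StepPairs

end ConeRung

end Summit.ResolutionOfSingularities.ResolutionOfSingularities.Theorems

end
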